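import Mathlib
import HarnessLib
import Summits.HubbardSuperconductivity.HubbardSuperconductivity.Theorems.KLProgrammeLatticeSoftBubbleModel
import Summits.HubbardSuperconductivity.HubbardSuperconductivity.Theorems.KLProgrammeLatticeSoftBubbleSharpZS

/-!
# Route `KLProgramme` — ENGINE item stmt-HubbardSuperconductivity-20437 `KLRegimeEngineV17F2`, class-#5 STEP (X).3 pinned pair «88b» /
# located-risk #14: THE SIGNED SOFT FORWARD BUBBLE ON THE MODEL'S OWN BAND (`…LatticeSoftBubbleModel` §4) with the SHARP zero-sound term
# (cell gate-hubbard-kl, seat hubbard-kl-k3c2-p2 g22, technique «thermal-bar induction n ≤ nScales β + 1 with EngineBoundsAtV4S sums»)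

Text-faithful twins (suffix `S`) of `klfl_lattice_soft_bubble_norm_le_model` / `_model_regime` built on `klfl_lattice_soft_bubble_norm_leS`
(…LatticeSoftBubbleSharpZS): the zero-sound coefficient `(524288/π)·(ℓ + 8M_F)` becomes `(64/π)·M_F`; every other term and every hypothesis is unchanged
(the dictionary §1–§3 of `…LatticeSoftBubbleModel` is imported, not restated).
Pure analysis + dictionary; nothing about the model's effective action is asserted; nothing asserts (X).3, (c), K3 or superconductivity.
References: BGM 2006 §2.4–2.5 [cite: BenfattoGiulianiMastropietro2006]; FST 1998 App. B [cite: FeldmanSalmhoferTrubowitz1998].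
-/

noncomputable section

namespace Summit.HubbardSuperconductivity.HubbardSuperconductivity.Theorems.KLRegimeSplit

set_option linter.dupNamespace false -- summit = problem name (single-conjunct summit), D-0017

open Real Set MeasureTheory Complex Literature.MathematicalPhysics.QuantumLattice
open Literature.Probability.LatticeModels hiding torusSupNorm
open Literature.MathematicalPhysics.QuantumLattice.BandSectorCounting
open Summit.HubbardSuperconductivity.HubbardSuperconductivity.Theorems.PerturbedFermiCurve
open Summit.HubbardSuperconductivity.HubbardSuperconductivity.Theorems.KLProgrammeLegKernels
open Summit.HubbardSuperconductivity.HubbardSuperconductivity.Theorems.DispersionFlow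
open Summit.HubbardSuperconductivity.HubbardSuperconductivity.Theorems.TwoPointAssembly
open Summit.HubbardSuperconductivity.HubbardSuperconductivity.Theorems.EngineV8
open scoped NNReal

/-! ## The signed soft forward bubble on the model band, sharp zero-sound term -/

section Model

variable {a' b' : ℝ} (B : BandBounds a' b') {R : RenConsts} {U μ : ℝ} {N : ℕ} {K : TrigPolyC4v} {A : ℝ}

/-- **THE SIGNED SOFT FORWARD BUBBLE ON THE MODEL BAND** (see the module docstring): `klfl_lattice_soft_bubble_norm_le` at `eb = E_K`, `eb' = E_K(· + klrepr q̃)`,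
`δ = δ_K`, `κ₀ = κ₁ = κ₂ = 4A`, `L_e = L_e' = G = 4 + (8/3)Gfr₁U²`, `δ_max = G·klTorusNorm L q̃`, `zm = 1/10`. -/
theorem klfl_lattice_soft_bubble_norm_le_modelS (hR : ∀ j, 0 ≤ R.Gfr j) (hK : FrameOK R U N μ K)
    (hAb : ∀ p : Momentum, ∀ j ≤ 2, ‖iteratedFDeriv ℝ j (frameShift K) p‖ ≤ A) (hA : 4 * A < B.Dtmin) (hA20 : 4 * A ≤ 1 / 20) (hμ : μ ≤ -0.15)
    {a : ℝ × ℝ → ℂ} (ha : Continuous a) (ha1 : ∀ x y, a (x + 2 * π, y) = a (x, y)) (ha2 : ∀ x y, a (x, y + 2 * π) = a (x, y))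
    {A₀ La : ℝ} (hA0 : ∀ p, ‖a p‖ ≤ A₀) (hLa : ∀ p q, ‖a p - a q‖ ≤ La * dist p q)
    {n : ℕ} (hn1 : 1 ≤ n) {L : ℕ} [NeZero L] (q : TorusSite 2 L)
    (hq : (4 + 8 / 3 * R.Gfr 1 * U ^ 2) * klTorusNorm L q ≤ klScale klE0 n / 8)
    {f f' : ℝ → ℂ} {Lf Mf ℓf Lf' Mf' ℓ' LF MF ℓ : ℝ}
    (hlip : ∀ s s', ‖f s - f s'‖ ≤ Lf * |s - s'|) (hbd : ∀ s, ‖f s‖ ≤ Mf) (hLf : Lf ≤ ℓf / klScale klE0 n ^ 2)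
    (hin : ∀ s, s ≤ (klScale klE0 n / 2) ^ 2 → f s = 0) (hout : ∀ s, (4 * klScale klE0 n) ^ 2 ≤ s → f s = 0)
    (hlip' : ∀ s s', ‖f' s - f' s'‖ ≤ Lf' * |s - s'|) (hbd' : ∀ s, ‖f' s‖ ≤ Mf') (hLf' : Lf' ≤ ℓ' / klScale klE0 n ^ 2)
    (hout' : ∀ s, (4 * klScale klE0 n) ^ 2 ≤ s → f' s = 0)
    (hMF : 0 ≤ MF) (hFlip : ∀ s s', ‖f s * f' s - f s' * f' s'‖ ≤ LF * |s - s'|) (hFbd : ∀ s, ‖f s * f' s‖ ≤ MF)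
    (hLF : LF ≤ ℓ / klScale klE0 n ^ 2)
    (hlo : a' < μ - 4 * klScale klE0 n - 4 * A) (hhi : μ + 4 * klScale klE0 n + 4 * A < b')
    {q₀ : ℝ} (hq₀ : |q₀| ≤ klScale klE0 n / 8) {β : ℝ} (hβ : klBetaMin ≤ β) (hn : n ≤ nScales β + 1) {M : ℕ}
    (hM : β * (4 * klScale klE0 n) / (2 * Real.pi) + 1 ≤ M) :
    ‖β⁻¹ • ∑ i : MatsubaraIdx M, ((L ^ 2 : ℕ) : ℝ)⁻¹ • ∑ k : TorusSite 2 L,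
        a (latticeMomentum L k 0, latticeMomentum L k 1) *
          klfb_prop f (matsubaraFreq β M i) (nambuXiCT L μ K k) *
            klfb_prop f' (matsubaraFreq β M i + q₀) (nambuXiCT L μ K (k + q))‖ ≤
      ((2 * π) ^ 2)⁻¹ *
          (2 * Real.pi *
            (64 / Real.pi * MF *
                (Real.pi * Real.sqrt 2 / (B.Dtmin - 4 * A) * (La + A₀ * (2 / (1 / 10))) / (B.Dtmin - 4 * A) +
                  A₀ * (1 / (B.Dtmin - 4 * A) ^ 2 + Real.pi * Real.sqrt 2 * (2 + 4 * A) / (B.Dtmin - 4 * A) ^ 3)) * klScale klE0 n +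
              393216 / Real.pi * (ℓ + 8 * MF) * (A₀ * (Real.pi * Real.sqrt 2 / (B.Dtmin - 4 * A))) * ((Real.pi / β) / klScale klE0 n) +
              256 / Real.pi * Mf * (A₀ * (Real.pi * Real.sqrt 2 / (B.Dtmin - 4 * A))) *
                ((65 * ℓ' + 17408 / 3 * Mf') / klScale klE0 n ^ 2 * klScale klE0 n) *
                  (|q₀| + (4 + 8 / 3 * R.Gfr 1 * U ^ 2) * klTorusNorm L q))) +
        32 * klScale klE0 n *
            (La * (2 * Mf / klScale klE0 n) * (16 * Mf' / klScale klE0 n) +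
              A₀ * ((9 * ℓf + 4 * Mf) / klScale klE0 n ^ 2 * (4 + 8 / 3 * R.Gfr 1 * U ^ 2)) * (16 * Mf' / klScale klE0 n) +
              A₀ * (2 * Mf / klScale klE0 n) * ((65 * ℓ' + 17408 / 3 * Mf') / klScale klE0 n ^ 2 * (4 + 8 / 3 * R.Gfr 1 * U ^ 2))) / L := by
  -- frame data
  have hsm := frameShift_toLp_small hAb le_rfl
  have hA0' : 0 ≤ A := le_trans (norm_nonneg _) (hAb 0 0 (by norm_num))
  have hG0 : 0 ≤ 4 + 8 / 3 * R.Gfr 1 * U ^ 2 := by nlinarith [hR 1, sq_nonneg U]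
  have hδmax0 : 0 ≤ (4 + 8 / 3 * R.Gfr 1 * U ^ 2) * klTorusNorm L q :=
    mul_nonneg hG0 (by unfold klTorusNorm KLProgrammeLegKernels.torusSupNorm torusAbs; positivity)
  have hD2 : ∀ θ s t : ℝ, s ∈ Icc 0 (π / ‖dir θ‖) → t ∈ Icc 0 (π / ‖dir θ‖) →
      |fderiv ℝ (fun k : Fin 2 → ℝ => frameShift K (WithLp.toLp 2 k)) (s • dir θ) (dir θ) -
        fderiv ℝ (fun k : Fin 2 → ℝ => frameShift K (WithLp.toLp 2 k)) (t • dir θ) (dir θ)| ≤ 4 * A * |s - t| :=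
    fun θ s t _ _ => klrk_radial_fderiv_lipschitz (contDiff_frameShift_toLp K) hsm.2.2 (norm_dir_le_one θ) s t
  -- the shift bound with the nearest representative
  have hshift : ∀ p : ℝ × ℝ, |klbandShift μ K (klrepr L q) p - klbandPl μ K p| ≤ (4 + 8 / 3 * R.Gfr 1 * U ^ 2) * klTorusNorm L q := fun p => by
    have h := abs_klbandShift_sub_le hR hK (klrepr L q) p
    rwa [norm_klrepr_eq] at h
  -- the zone margin
  have hKb : ∀ k : Fin 2 → ℝ, |K.eval k| ≤ 1 / 20 := fun k => (abs_eval_le_of_C2 hAb k).trans hA20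
  have hzone : ∀ p ∈ Icc (-π) π ×ˢ Icc (-π) π, |klbandPl μ K p| < 4 * klScale klE0 n → |p.1| ≤ π - 2 * (1 / 10) ∧ |p.2| ≤ π - 2 * (1 / 10) :=
    fun p hp he => klbandPl_zone hμ hKb hn1 p hp he
  -- the row
  have h := klfl_lattice_soft_bubble_norm_leS B (contDiff_frameShift_toLp K) (fun k _ => hsm.1 k) (fun k _ => hsm.2.1 k) hA
    (κ₂ := 4 * A) (by positivity) hD2 ha ha1 ha2 hA0 hLa
    (continuous_klbandPl μ K) (klbandPl_periodic₁ μ K) (klbandPl_periodic₂ μ K) (klbandPl_lipschitz hR hK) (μ := μ)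
    (fun p _ => klbandPl_eq_klfb_band μ K p)
    (continuous_klbandShift μ K (klrepr L q)) (klbandShift_periodic₁ μ K _) (klbandShift_periodic₂ μ K _) (klbandShift_lipschitz hR hK _)
    hδmax0 hq hshift (zm := 1 / 10) (by norm_num) hzone hlip hbd hLf hin hout hlip' hbd' hLf' hout' hMF hFlip hFbd hLF hlo hhi hq₀ hβ hn hM L
  -- the lattice values of the two bands
  have hsum : (∑ i : MatsubaraIdx M, ((L ^ 2 : ℕ) : ℝ)⁻¹ • ∑ k : TorusSite 2 L,
        a (latticeMomentum L k 0, latticeMomentum L k 1) *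
          klfb_prop f (matsubaraFreq β M i) (nambuXiCT L μ K k) *
            klfb_prop f' (matsubaraFreq β M i + q₀) (nambuXiCT L μ K (k + q))) =
      ∑ i : MatsubaraIdx M, ((L ^ 2 : ℕ) : ℝ)⁻¹ • ∑ k : TorusSite 2 L,
        a (latticeMomentum L k 0, latticeMomentum L k 1) *
          klfb_prop f (matsubaraFreq β M i) (klbandPl μ K (latticeMomentum L k 0, latticeMomentum L k 1)) *
            klfb_prop f' (matsubaraFreq β M i + q₀) (klbandShift μ K (klrepr L q) (latticeMomentum L k 0, latticeMomentum L k 1)) := by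
    refine Finset.sum_congr rfl fun i _ => ?_
    congr 1
    refine Finset.sum_congr rfl fun k _ => ?_
    rw [klbandPl_latticeMomentum, klbandShift_repr_latticeMomentum]
  rw [hsum]
  exact h

/-- **THE SAME, KEYED ON THE KL REGIME**: `FrameOK R U (nScales β) μ K`, `klBetaMin ≤ β ≤ e^{c/U²}`, `0 ≤ c`, with `A := 2Gfr₀|U| + 2Gfr₁U² + Gfr₂·c/log 4`
(`klrk_frame_C2_bound`). -/
theorem klfl_lattice_soft_bubble_norm_le_model_regimeS (hR : ∀ j, 0 ≤ R.Gfr j) {c β : ℝ} (hc : 0 ≤ c) (hβ : klBetaMin ≤ β)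
    (hβc : β ≤ Real.exp (c / U ^ 2)) (hK : FrameOK R U (nScales β) μ K)
    (hA : 4 * (2 * R.Gfr 0 * |U| + 2 * R.Gfr 1 * U ^ 2 + R.Gfr 2 * (c / Real.log 4)) < B.Dtmin)
    (hA20 : 4 * (2 * R.Gfr 0 * |U| + 2 * R.Gfr 1 * U ^ 2 + R.Gfr 2 * (c / Real.log 4)) ≤ 1 / 20) (hμ : μ ≤ -0.15)
    {a : ℝ × ℝ → ℂ} (ha : Continuous a) (ha1 : ∀ x y, a (x + 2 * π, y) = a (x, y)) (ha2 : ∀ x y, a (x, y + 2 * π) = a (x, y))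
    {A₀ La : ℝ} (hA0 : ∀ p, ‖a p‖ ≤ A₀) (hLa : ∀ p q, ‖a p - a q‖ ≤ La * dist p q)
    {n : ℕ} (hn1 : 1 ≤ n) {L : ℕ} [NeZero L] (q : TorusSite 2 L)
    (hq : (4 + 8 / 3 * R.Gfr 1 * U ^ 2) * klTorusNorm L q ≤ klScale klE0 n / 8)
    {f f' : ℝ → ℂ} {Lf Mf ℓf Lf' Mf' ℓ' LF MF ℓ : ℝ}
    (hlip : ∀ s s', ‖f s - f s'‖ ≤ Lf * |s - s'|) (hbd : ∀ s, ‖f s‖ ≤ Mf) (hLf : Lf ≤ ℓf / klScale klE0 n ^ 2)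
    (hin : ∀ s, s ≤ (klScale klE0 n / 2) ^ 2 → f s = 0) (hout : ∀ s, (4 * klScale klE0 n) ^ 2 ≤ s → f s = 0)
    (hlip' : ∀ s s', ‖f' s - f' s'‖ ≤ Lf' * |s - s'|) (hbd' : ∀ s, ‖f' s‖ ≤ Mf') (hLf' : Lf' ≤ ℓ' / klScale klE0 n ^ 2)
    (hout' : ∀ s, (4 * klScale klE0 n) ^ 2 ≤ s → f' s = 0)
    (hMF : 0 ≤ MF) (hFlip : ∀ s s', ‖f s * f' s - f s' * f' s'‖ ≤ LF * |s - s'|) (hFbd : ∀ s, ‖f s * f' s‖ ≤ MF)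
    (hLF : LF ≤ ℓ / klScale klE0 n ^ 2)
    (hlo : a' < μ - 4 * klScale klE0 n - 4 * (2 * R.Gfr 0 * |U| + 2 * R.Gfr 1 * U ^ 2 + R.Gfr 2 * (c / Real.log 4)))
    (hhi : μ + 4 * klScale klE0 n + 4 * (2 * R.Gfr 0 * |U| + 2 * R.Gfr 1 * U ^ 2 + R.Gfr 2 * (c / Real.log 4)) < b')
    {q₀ : ℝ} (hq₀ : |q₀| ≤ klScale klE0 n / 8) (hn : n ≤ nScales β + 1) {M : ℕ}
    (hM : β * (4 * klScale klE0 n) / (2 * Real.pi) + 1 ≤ M) :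
    ‖β⁻¹ • ∑ i : MatsubaraIdx M, ((L ^ 2 : ℕ) : ℝ)⁻¹ • ∑ k : TorusSite 2 L,
        a (latticeMomentum L k 0, latticeMomentum L k 1) *
          klfb_prop f (matsubaraFreq β M i) (nambuXiCT L μ K k) *
            klfb_prop f' (matsubaraFreq β M i + q₀) (nambuXiCT L μ K (k + q))‖ ≤
      ((2 * π) ^ 2)⁻¹ *
          (2 * Real.pi *
            (64 / Real.pi * MF *
                (Real.pi * Real.sqrt 2 / (B.Dtmin - 4 * (2 * R.Gfr 0 * |U| + 2 * R.Gfr 1 * U ^ 2 + R.Gfr 2 * (c / Real.log 4))) * (La + A₀ * (2 / (1 / 10))) /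
                    (B.Dtmin - 4 * (2 * R.Gfr 0 * |U| + 2 * R.Gfr 1 * U ^ 2 + R.Gfr 2 * (c / Real.log 4))) +
                  A₀ * (1 / (B.Dtmin - 4 * (2 * R.Gfr 0 * |U| + 2 * R.Gfr 1 * U ^ 2 + R.Gfr 2 * (c / Real.log 4))) ^ 2 +
                    Real.pi * Real.sqrt 2 * (2 + 4 * (2 * R.Gfr 0 * |U| + 2 * R.Gfr 1 * U ^ 2 + R.Gfr 2 * (c / Real.log 4))) /
                      (B.Dtmin - 4 * (2 * R.Gfr 0 * |U| + 2 * R.Gfr 1 * U ^ 2 + R.Gfr 2 * (c / Real.log 4))) ^ 3)) * klScale klE0 n +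
              393216 / Real.pi * (ℓ + 8 * MF) *
                  (A₀ * (Real.pi * Real.sqrt 2 / (B.Dtmin - 4 * (2 * R.Gfr 0 * |U| + 2 * R.Gfr 1 * U ^ 2 + R.Gfr 2 * (c / Real.log 4))))) *
                ((Real.pi / β) / klScale klE0 n) +
              256 / Real.pi * Mf * (A₀ * (Real.pi * Real.sqrt 2 / (B.Dtmin - 4 * (2 * R.Gfr 0 * |U| + 2 * R.Gfr 1 * U ^ 2 + R.Gfr 2 * (c / Real.log 4))))) *
                ((65 * ℓ' + 17408 / 3 * Mf') / klScale klE0 n ^ 2 * klScale klE0 n) *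
                  (|q₀| + (4 + 8 / 3 * R.Gfr 1 * U ^ 2) * klTorusNorm L q))) +
        32 * klScale klE0 n *
            (La * (2 * Mf / klScale klE0 n) * (16 * Mf' / klScale klE0 n) +
              A₀ * ((9 * ℓf + 4 * Mf) / klScale klE0 n ^ 2 * (4 + 8 / 3 * R.Gfr 1 * U ^ 2)) * (16 * Mf' / klScale klE0 n) +
              A₀ * (2 * Mf / klScale klE0 n) * ((65 * ℓ' + 17408 / 3 * Mf') / klScale klE0 n ^ 2 * (4 + 8 / 3 * R.Gfr 1 * U ^ 2))) / L :=
  klfl_lattice_soft_bubble_norm_le_modelS B hR hK (klrk_frame_C2_bound hR hc hβ hβc hK) hA hA20 hμ ha ha1 ha2 hA0 hLa hn1 q hq hlip hbd hLf hin hout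
    hlip' hbd' hLf' hout' hMF hFlip hFbd hLF hlo hhi hq₀ hβ hn hM

end Model

end Summit.HubbardSuperconductivity.HubbardSuperconductivity.Theorems.KLRegimeSplit

end
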